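import Summits.QuantumFields.BalabanUV.Beta.EriceRemainderEnclosureHistoryAutonomyComparisonAgeCompositionThreeAgesDefectAbs

/-!
# EriceRemainderEnclosureHistoryAutonomyComparisonAgeCompositionThreeAgesDefectEnvelope — (E88a) route (N), first order, THREE loaded ages: the reduction
# (E87o) and the socket (E87p) UNDER AN UPPER DAMPING ENVELOPE `g ≤ gU` — the (S-h°) member of the pair `(k₂,k₃)` from the inequality (★h°[gU]) in
# which the entering old entry, the defect weight and the young entries of the LEFT side keep the envelope's dampings (`r·gU_{m+k₃+1}`, `1 − r·gU_{m+k₃+1}`,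
# `q_{n₀}·Π gU`) instead of their undamped values — because the undamped («every damping at its own worst end») form (★h°) = (★h°[1]) is NOT k-uniform

Cell `pub-balaban`, β-function sub-cell, BINDER row D4 «RemainderConst leaves for Bałaban's split» (`HOME/BINDER-OWNERS.md`; owner lineage `b2b-balaban-beta-an4`;
this file by co-owner #2 lineage `b2b-balaban-beta-d4-p2`, generation 79), β-FLOW TEAM duty (1), FREEZE (0) honoured (def-free; imports (E87p); uses (E87n)
`flow_nonneg_three_ages_abs_static`, (E87i) `rho_mid_three_le`, (E80d) `aggregate_eq_sum`, (E80e) `age_chain_closes`, (E82b) `row_mass_le` ∕ `load_le_of_window`,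
(E82c) `kernel_zero` ∕ `kernel_entry_le`, (E84a) `inv_prod_le_prod_damping`, (E81) `defect_nonneg` BY NAME; nothing restated).

HONEST FRAMING (page 1, verbatim and binding).  *"Discharging BetaPertH makes Bałaban's UV stability UNCONDITIONAL — a real constructive-QFT result; it is
NOT the continuum limit and NOT the Clay problem."*  THIS FILE DISCHARGES NOTHING OF THE KIND.  Elementary real analysis about ABSTRACT functionals on a box
]0,γ]^ℕ with displayed floors, profiles and signs, and the FIRST-ORDER renewal objects of route (N) built from them — hypotheses of a census, not facts; the
form, signs, ages and moments of Bałaban's (1.22) limit functional are NOT PRINTED ([I] p. 298; GAPS G-t4-U2-1∕-2) and NOT asserted.  Row D4 class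
UNCHANGED (critical-path width 0; instance 0∕1; D4 DISCHARGE NO DATE).  HONEST DEPENDENCY: continuum YM on T⁴ ⇐ BetaPertH ∧ nine spine estimates (0/9
proved); BetaPertH ⇐ (D1) ∧ (D4) ∧ CAP+tail; G-an2-4 gates asym, D1 and NE2/3/4.

THE POINT (census sense (α); route (N); README `HOME/b2b-balaban-beta-d4-p2/g79/e88/README.md` §1–§3).  THE FINDING of generation 79: on the young-saturated
infrared corner with comparable windows (`L₁` saturating the domination, `L_{k₂}, L_{k₃} → 0`, `k₂ = k₃ − 1`, pin `m = 0`) the damping-free inequality (★h°) of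
(E87o)∕(E87p) has log-margin `0.42∕0.29∕0.19∕0.12∕0.062∕0.017` at `k₃ = 16∕32∕64∕128∕256∕512` and the limit `ln ∫₀¹ 2x^{1∕3}s(x)∕(1+x) dx ≈ −0.18 < 0`: it is NOT
k-uniform (its product form «v5» of (E87r) already fails at `k₃ = 256`); two decouplings cost it — the defect's damping `g_{m+k₃+1}` taken as `1` (the exact
weight is `1 − r·g_{m+k₃+1} ≈ (1−r)(1 + F∕(1−r))`, a factor `4∕3` in that corner) and the left young entries taken undamped.  Both are repaired by an UPPER
ENVELOPE of the damping class: for the self-consistent damping `g_t = 1∕(1+f_t)` one has `g_t ≤ 1∕(1+F♭_t)`, `F♭` the floor-damped load, and with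
`gU = 1∕(1+F♭)` the repaired inequality (★h°[gU]) keeps the margin `0.70∕0.59∕0.51∕0.45∕0.40∕0.36` (same corner, limit ≈ 0.22).  This file is ABSTRACT in
the envelope: §1 **`static_defect_abs_of_product_env`** — (S-h°) at a pin from (★h°[gU]) for ANY `gU ≥ g` (the exact left side is
`r·g_{m+k₃+1}·c_m·Σ_l KL k₂ (n₀) l`, the exact defect weight `1 − r·g_{m+k₃+1}`; both are AFFINE in the one damping `G = g_{m+k₃+1}`, so the inequality at
`G = gU_{m+k₃+1}` and at `G = 0` (trivial) give it at `G`); §2 **`flow_nonneg_three_ages_of_product_abs_env`** — the socket (E87p) with `hprod` := (★h°[gU])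
and the extra hypothesis `g ≤ gU`.  With `gU ≡ 1` both are (E87o)∕(E87p) verbatim.  NOT CLAIMED: (★h°[gU]) along flows for any envelope (successor;
census README §3); anything nonlinear; anything printed — NOT B12 Thm 2, NOT BetaPertH.

WHAT IS PROVED ([folklore]; 0 `def`, 0 sorry).  §1 `prod_damping_le_env`, **`static_defect_abs_of_product_env`**; §2 **`flow_nonneg_three_ages_of_product_abs_env`**;
§3 (v1.1, same unit and generation; APPENDED, nothing above modified) **`selfconsistent_le_floor_env`** (the backward self-consistent damping `g = 1∕(1+f)`,
`f_t = Σ_k L_k h_{t+k}³∕2·Π_{(t,t+k]} g`, satisfies `g ≤ 1∕(1+F♭)`, `F♭` the floor-damped load), `floor_env_bounds`.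
-/
noncomputable section
open Finset

namespace Summit.QuantumFields.BalabanUV.Beta.EriceRemainderEnclosureHistoryAutonomyComparisonAgeCompositionThreeAgesDefectEnvelope

open Literature.MathematicalPhysics.QuantumFieldTheory.Balaban1983to89
open Literature.MathematicalPhysics.QuantumFieldTheory.Balaban1983to89.T4BetaStationary
open Literature.MathematicalPhysics.QuantumFieldTheory.Balaban1983to89.T4BetaFlowWellPosed
open Summit.QuantumFields.BalabanUV.Beta.EriceRemainderEnclosureHistoryAutonomyOrder (strictAnti_of_memFlow)
open Summit.QuantumFields.BalabanUV.Beta.EriceRemainderEnclosureHistoryAutonomyComparisonAgeCompositionIdentification (defect_nonneg)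
open Summit.QuantumFields.BalabanUV.Beta.EriceRemainderEnclosureHistoryAutonomyComparisonAgeCompositionYoungestTailSumFlow (kernel_entry_le row_mass_le
  load_le_of_window)
open Summit.QuantumFields.BalabanUV.Beta.EriceRemainderEnclosureHistoryAutonomyComparisonAgeCompositionYoungestTailSumWiring (kernel_zero)
open Summit.QuantumFields.BalabanUV.Beta.EriceRemainderEnclosureHistoryAutonomyComparisonAgeCompositionDecayReduction (inv_prod_le_prod_damping)
open Summit.QuantumFields.BalabanUV.Beta.EriceRemainderEnclosureHistoryAutonomyComparisonAgeCompositionChainWiring (aggregate_eq_sum)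
open Summit.QuantumFields.BalabanUV.Beta.EriceRemainderEnclosureHistoryAutonomyComparisonAgeCompositionChainWiringAtPin (age_chain_closes)
open Summit.QuantumFields.BalabanUV.Beta.EriceRemainderEnclosureHistoryAutonomyComparisonAgeCompositionThreeAgesAbs (flow_nonneg_three_ages_abs_static)
open Summit.QuantumFields.BalabanUV.Beta.EriceRemainderEnclosureHistoryAutonomyComparisonAgeCompositionThreeAgesDefectReduction (rho_mid_three_le)

variable {B : (ℕ → ℝ) → ℝ} {γ b gIR : ℝ} {L : ℕ → ℝ} {K : ℕ} {h g gU : ℕ → ℝ} {KL θ : ℕ → ℕ → ℕ → ℝ} {ρ : ℕ → ℕ → ℝ}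

/-! ## §1 (S-h°) at a pin from (★h°[gU]) -/

/-- Damping products lie below the envelope's products: `Π_{t∈s} g_t ≤ Π_{t∈s} gU_t` for `0 < g ≤ gU`. [folklore] -/
theorem prod_damping_le_env (hg : ∀ t, 0 < g t ∧ g t ≤ 1) (hgU : ∀ t, g t ≤ gU t) (s : Finset ℕ) :
    ∏ t ∈ s, g t ≤ ∏ t ∈ s, gU t :=
  prod_le_prod (fun t _ => (hg t).1.le) fun t _ => hgU t

/-- **(S-h°) AT A PIN FROM THE ENVELOPE INEQUALITY (★h°[gU]).**  As (E87o) `static_defect_abs_of_product` (same letters `q`, `c`, `F`, `Pf`, `XA`, `Tτ`, `TA`,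
`ρUp`, `τlo`, `ALa`; `r = (h_{m+k₃+1}∕h_{m+k₃})³`, `n₀ = m+1+k₃`), for a damping `g` of the relaxed class lying BELOW an envelope `gU` (any `gU ≥ g`;
`gU ≤ 1` is not needed).  IF for every
`j ≥ m+1+k₃` **(★h°[gU])** `r·gU_{m+k₃+1}·q_{n₀}·Σ_{l<k₂} [m+2+k₃+l ≤ j]·Π_{t∈[n₀+1+l, n₀+k₂]} gU_t ≤ (1 − r·gU_{m+k₃+1})·Σ_{l'<k₃} Pf(m+1+l',m+k₃)·ALa_j(m+1+l')
+ r·gU_{m+k₃+1}·Pf(m+1,m+k₃)·ALa_j(m+1)`, THEN the (S-h°) member holds at `m`: the exact left side is `r·G·c_m·Σ_l [⋯]·KL k₂ n₀ l` and the exact defect weight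
is `θ k₃ m 1 = 1 − r·G` with the SAME damping `G = g_{m+k₃+1} ≤ gU_{m+k₃+1}`; the required inequality is affine in `G`, true at `G = 0`, and (★h°[gU]) is
it at `G = gU_{m+k₃+1}`. [folklore] -/
theorem static_defect_abs_of_product_env (hL : ∀ k, 0 ≤ L k) (hh : SeqBox γ h) (hanti : Antitone h)
    (hg : ∀ t, 0 < g t ∧ g t ≤ 1) (hgF : ∀ t, 1 / (1 + ∑ k ∈ range K, L k * h (t + k) ^ 3 / 2) ≤ g t)
    (hgU : ∀ t, g t ≤ gU t)
    {k₂ k₃ : ℕ} (hk2 : 2 ≤ k₂) (hk23 : k₂ < k₃) (hk3K : k₃ < K)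
    (hKL : ∀ k n l, KL k n l = if 0 < k ∧ k < K ∧ l < k then L k * h (n + k) ^ 3 / 2 * ∏ t ∈ Ico (n + 1 + l) (n + k + 1), g t else 0)
    (hθ : ∀ k n l, θ k n l = 1 - (h (n + k + l) / h (n + k)) ^ 3 * ∏ t ∈ Ico (n + k + 1) (n + k + l + 1), g t)
    (hρ1 : ∀ p, ρ k₂ p ≤ 1)
    {q c F ρUp XA τlo : ℕ → ℝ} {Pf Tτ ALa : ℕ → ℕ → ℝ} {TA : ℕ → ℕ → ℕ → ℝ}
    (hq : ∀ n, q n = L k₂ * h (n + k₂) ^ 3 / 2) (hc : ∀ n, c n = L k₃ * h (n + k₃) ^ 3 / 2)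
    (hF : ∀ t, F t = ∑ j ∈ range K, L j * h (t + j) ^ 3 / 2) (hPf : ∀ a b, Pf a b = (∏ t ∈ Ico a (b + 1), (1 + F t))⁻¹)
    (hx34 : ∀ n, 1 ≤ n → k₃ * c n ≤ 3 / 4) (hXA : ∀ p, 1 ≤ p → XA p ≤ k₃ * c p)
    (hTτ : ∀ m p', Tτ m p' = max (max (max ((1 - ρ k₂ p') * (1 - XA (m + 2))) ((1 - ρ k₂ p') * (1 - XA p')))
      ((1 - XA p') - ∑ l ∈ range K, KL k₂ p' l)) 0)
    (hTA : ∀ j m p, TA j m p = ∑ l ∈ range k₂, if p + 1 + l ≤ j then KL k₂ p l * Tτ m (p + 1 + l) else 0)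
    (hρle : ∀ p, 2 ≤ p → ρ k₂ p ≤ ρUp p)
    (hτlo : ∀ p', τlo p' = max (max ((1 - ρUp p') * (1 - k₃ * c p')) (1 - k₃ * c p' - k₂ * q p')) 0)
    (hALa : ∀ j p, ALa j p = q p * ∑ l ∈ range k₂, if p + 1 + l ≤ j then Pf (p + 1 + l) (p + k₂) * τlo (p + 1 + l) else 0)
    {m : ℕ}
    (hprod : ∀ j, m + 1 + k₃ ≤ j →
      (h (m + k₃ + 1) / h (m + k₃)) ^ 3 * gU (m + k₃ + 1) * q (m + 1 + k₃) *
          (∑ l ∈ range k₂, if m + 2 + k₃ + l ≤ j then ∏ t ∈ Ico (m + 1 + k₃ + 1 + l) (m + 1 + k₃ + k₂ + 1), gU t else 0) ≤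
        (1 - (h (m + k₃ + 1) / h (m + k₃)) ^ 3 * gU (m + k₃ + 1)) * ∑ l' ∈ range k₃, Pf (m + 1 + l') (m + k₃) * ALa j (m + 1 + l') +
          (h (m + k₃ + 1) / h (m + k₃)) ^ 3 * gU (m + k₃ + 1) * (Pf (m + 1) (m + k₃) * ALa j (m + 1))) :
    ∀ j, m + 1 + k₃ ≤ j →
      KL k₃ (m + 1) (k₃ - 1) * ∑ l ∈ range k₂, (if m + 2 + k₃ + l ≤ j then KL k₂ (m + 1 + k₃) l else 0) ≤
        (1 - (1 - θ k₃ m 1)) * ∑ l' ∈ range k₃, KL k₃ m l' * TA j m (m + 1 + l') + (1 - θ k₃ m 1) * (KL k₃ m 0 * TA j m (m + 1)) := by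
  intro j hj
  have hpos : ∀ n, 0 < h n := fun n => (hh n).1
  have hk2K : k₂ < K := by omega
  have hF0 : ∀ t, 0 ≤ F t := fun t => by
    rw [hF]; exact sum_nonneg fun j _ => by have := hL j; have := hpos (t + j); positivity
  have hgF' : ∀ t, 1 / (1 + F t) ≤ g t := fun t => by rw [hF]; exact hgF t
  have hq0 : ∀ n, 0 ≤ q n := fun n => by rw [hq]; have := hL k₂; have := hpos (n + k₂); positivity
  have hc0 : ∀ n, 0 ≤ c n := fun n => by rw [hc]; have := hL k₃; have := hpos (n + k₃); positivity
  have hPf0 : ∀ a b, 0 ≤ Pf a b := fun a b => by rw [hPf]; exact inv_nonneg.mpr (prod_nonneg fun t _ => by have := hF0 t; positivity)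
  have hgU0 : ∀ t, 0 ≤ gU t := fun t => (hg t).1.le.trans (hgU t)
  -- the letters of the pin: r, the one damping G and its envelope value GU
  set r : ℝ := (h (m + k₃ + 1) / h (m + k₃)) ^ 3 with hr
  set G : ℝ := g (m + k₃ + 1) with hG
  set GU : ℝ := gU (m + k₃ + 1) with hGU
  have hr0 : 0 ≤ r := by have := hpos (m + k₃ + 1); have := hpos (m + k₃); positivity
  have hG0 : 0 < G := (hg _).1
  have hGle : G ≤ GU := hgU _
  have hr3 : h (m + k₃ + 1) ^ 3 = r * h (m + k₃) ^ 3 := by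
    rw [hr, div_pow, div_mul_cancel₀ _ (pow_ne_zero 3 (hpos _).ne')]
  have hent : KL k₃ (m + 1) (k₃ - 1) = r * c m * G := by
    rw [hKL, if_pos ⟨by omega, hk3K, by omega⟩, show m + 1 + 1 + (k₃ - 1) = m + k₃ + 1 by omega, show m + 1 + k₃ + 1 = m + k₃ + 1 + 1 by ring,
      Nat.Ico_succ_singleton, prod_singleton, hc, show m + 1 + k₃ = m + k₃ + 1 by ring, hr3]
    ring
  have hθm : θ k₃ m 1 = 1 - r * G := by rw [hθ, Nat.Ico_succ_singleton, prod_singleton]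
  have hθ0 : 0 ≤ 1 - r * G := by have := defect_nonneg hpos hanti hg hθ k₃ m 1; rwa [hθm] at this
  -- LEFT: the young entries below the envelope's products
  set Yup : ℝ := q (m + 1 + k₃) * ∑ l ∈ range k₂, (if m + 2 + k₃ + l ≤ j then ∏ t ∈ Ico (m + 1 + k₃ + 1 + l) (m + 1 + k₃ + k₂ + 1), gU t else 0)
    with hYup
  have hYup0 : 0 ≤ Yup :=
    mul_nonneg (hq0 _) (sum_nonneg fun l _ => by split_ifs <;> [exact prod_nonneg fun t _ => hgU0 t; exact le_rfl])
  have hleft : KL k₃ (m + 1) (k₃ - 1) * ∑ l ∈ range k₂, (if m + 2 + k₃ + l ≤ j then KL k₂ (m + 1 + k₃) l else 0) ≤ c m * (r * G * Yup) := by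
    have hS : ∑ l ∈ range k₂, (if m + 2 + k₃ + l ≤ j then KL k₂ (m + 1 + k₃) l else 0) ≤ Yup := by
      rw [hYup, mul_sum]
      refine sum_le_sum fun l hl => ?_
      have hlk : l < k₂ := mem_range.mp hl
      split_ifs
      · rw [hKL, if_pos ⟨by omega, hk2K, hlk⟩, ← hq]
        exact mul_le_mul_of_nonneg_left (prod_damping_le_env hg hgU _) (hq0 _)
      · simp
    rw [hent, show r * c m * G * _ = c m * (r * G * ∑ l ∈ range k₂, (if m + 2 + k₃ + l ≤ j then KL k₂ (m + 1 + k₃) l else 0)) by ring]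
    exact mul_le_mul_of_nonneg_left (mul_le_mul_of_nonneg_left hS (mul_nonneg hr0 hG0.le)) (hc0 m)
  -- RIGHT: the old entries at the floor, the young lower masses below `TA` (as (E87o))
  have hτlo0 : ∀ p', 0 ≤ τlo p' := fun p' => by rw [hτlo]; exact le_max_right _ _
  have hτle : ∀ p', m + 2 ≤ p' → τlo p' ≤ Tτ m p' := by
    intro p' hp'
    have hX : XA p' ≤ k₃ * c p' := hXA p' (by omega)
    have hq2 : ∑ l ∈ range K, KL k₂ p' l ≤ k₂ * q p' := by rw [hq]; exact row_mass_le hL hh hg hKL hk2K p'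
    have hρ0 : 0 ≤ 1 - ρ k₂ p' := by linarith [hρ1 p']
    have hb2 : (1 - ρUp p') * (1 - k₃ * c p') ≤ (1 - ρ k₂ p') * (1 - XA p') := by
      rcases le_or_gt 0 (1 - ρUp p') with hpos' | hneg
      · exact mul_le_mul (by linarith [hρle p' (by omega)]) (by linarith) (by linarith [hx34 p' (by omega)]) hρ0
      · have : (1 - ρUp p') * (1 - k₃ * c p') ≤ 0 := mul_nonpos_of_nonpos_of_nonneg hneg.le (by linarith [hx34 p' (by omega)])
        exact this.trans (mul_nonneg hρ0 (by linarith [hx34 p' (by omega)]))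
    have hb3 : 1 - k₃ * c p' - k₂ * q p' ≤ (1 - XA p') - ∑ l ∈ range K, KL k₂ p' l := by linarith
    rw [hτlo, hTτ]
    exact max_le (max_le (le_max_of_le_left (le_max_of_le_left (le_max_of_le_right hb2))) (le_max_of_le_left (le_max_of_le_right hb3))) (le_max_right _ _)
  have hALo0 : ∀ p, 0 ≤ ALa j p := fun p => by
    rw [hALa]; exact mul_nonneg (hq0 p) (sum_nonneg fun l _ => by split_ifs <;> [exact mul_nonneg (hPf0 _ _) (hτlo0 _); exact le_rfl])
  have hALge : ∀ p, m + 1 ≤ p → ALa j p ≤ TA j m p := by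
    intro p hp
    rw [hALa, hTA, mul_sum]
    refine sum_le_sum fun l hl => ?_
    have hlk : l < k₂ := mem_range.mp hl
    split_ifs with hpl
    · have hfloor : q p * Pf (p + 1 + l) (p + k₂) ≤ KL k₂ p l := by
        rw [hKL, if_pos ⟨by omega, hk2K, hlk⟩, ← hq, hPf]
        exact mul_le_mul_of_nonneg_left (inv_prod_le_prod_damping hF0 hgF' _) (hq0 p)
      have hprod' : (q p * Pf (p + 1 + l) (p + k₂)) * τlo (p + 1 + l) ≤ KL k₂ p l * Tτ m (p + 1 + l) :=
        mul_le_mul hfloor (hτle (p + 1 + l) (by omega)) (hτlo0 _) (kernel_entry_le hL hh hg hKL k₂ p l).1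
      linarith
    · simp
  have hold : ∀ l', l' < k₃ → c m * Pf (m + 1 + l') (m + k₃) ≤ KL k₃ m l' := fun l' hl' => by
    rw [hKL, if_pos ⟨by omega, hk3K, hl'⟩, ← hc, hPf]
    exact mul_le_mul_of_nonneg_left (inv_prod_le_prod_damping hF0 hgF' _) (hc0 m)
  set A' : ℝ := ∑ l' ∈ range k₃, Pf (m + 1 + l') (m + k₃) * ALa j (m + 1 + l') with hA'
  set B' : ℝ := Pf (m + 1) (m + k₃) * ALa j (m + 1) with hB'
  have hA0 : 0 ≤ A' := sum_nonneg fun l' _ => mul_nonneg (hPf0 _ _) (hALo0 _)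
  have hB0 : 0 ≤ B' := mul_nonneg (hPf0 _ _) (hALo0 _)
  have hAle : c m * A' ≤ ∑ l' ∈ range k₃, KL k₃ m l' * TA j m (m + 1 + l') := by
    rw [hA', mul_sum]
    refine sum_le_sum fun l' hl' => ?_
    rw [← mul_assoc]
    exact mul_le_mul (hold l' (mem_range.mp hl')) (hALge _ (by omega)) (hALo0 _) (kernel_entry_le hL hh hg hKL k₃ m l').1
  have hBle : c m * B' ≤ KL k₃ m 0 * TA j m (m + 1) := by
    rw [hB', ← mul_assoc]
    have h0 := hold 0 (by omega); rw [add_zero] at h0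
    exact mul_le_mul h0 (hALge _ (by omega)) (hALo0 _) (kernel_entry_le hL hh hg hKL k₃ m 0).1
  have hright : c m * ((1 - r * G) * A' + r * G * B') ≤
      (1 - (1 - θ k₃ m 1)) * ∑ l' ∈ range k₃, KL k₃ m l' * TA j m (m + 1 + l') + (1 - θ k₃ m 1) * (KL k₃ m 0 * TA j m (m + 1)) := by
    rw [hθm, sub_sub_cancel]
    have := mul_le_mul_of_nonneg_left hAle hθ0
    have := mul_le_mul_of_nonneg_left hBle (mul_nonneg hr0 hG0.le)
    nlinarith
  -- (★h°[gU]) is the required inequality at G = GU; it is affine in G and trivial at G = 0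
  have hGU : r * GU * Yup ≤ (1 - r * GU) * A' + r * GU * B' := by
    have := hprod j hj
    rw [mul_assoc (r * GU)] at this
    rwa [← hYup, ← hA', ← hB'] at this
  have hmid : r * G * Yup ≤ (1 - r * G) * A' + r * G * B' := by
    rcases le_or_gt 0 (B' - A' - Yup) with hX | hX
    · nlinarith [mul_nonneg (mul_nonneg hr0 hG0.le) hX]
    · nlinarith [mul_nonneg (mul_nonneg hr0 (sub_nonneg.2 hGle)) (neg_nonneg.2 hX.le)]
  exact hleft.trans ((mul_le_mul_of_nonneg_left hmid (hc0 m)).trans hright)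

/-! ## §2 The three-age socket on (★h°[gU]) -/

/-- **ROUTE (N), FIRST ORDER — THE THREE-AGE SOCKET ON THE ENVELOPE INEQUALITY (★h°[gU]).**  As (E87p) `flow_nonneg_three_ages_of_product_abs` (the
damped END for `{1,k₂,k₃}`, every horizon `N ≥ K = k₃+1`, every damping of the relaxed class, modulo (S-b)₁, (S-a)∨(S-d) for `(1,k₂)` and `(1,k₃)`, the tail
sums ∨ (S-e″) for the middle age, (S-c♯) ∨ (S-f) above it), for dampings lying below an envelope `gU` (`g ≤ gU`; e.g. `gU = 1∕(1+F♭)` with `F♭` the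
floor-damped load, which the self-consistent damping respects), with the pair `(k₂,k₃)` asking **(★h°[gU])** at every pin `m` and truncation `j ≥ m+1+k₃`
(displayed; `r_m = (h_{m+k₃+1}∕h_{m+k₃})³`; §1 `static_defect_abs_of_product_env` supplies the (S-h°) member).  CONCLUSION: `ε ≥ 0` at every pin for every
admissible excess. [folklore] -/
theorem flow_nonneg_three_ages_of_product_abs_env (hmono : ∀ u v : ℕ → ℝ, SeqBox γ u → SeqBox γ v → (∀ j, u j ≤ v j) → B u ≤ B v)
    (hL : ∀ k, 0 ≤ L k) (hb : 0 < b) (hlo : ∀ u, SeqBox γ u → b ≤ B u) (hdom : ∀ u, SeqBox γ u → ∑ k ∈ range K, L k * u k ≤ B u)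
    (hh : SeqBox γ h) (hf : MemFlow B gIR h)
    (hg : ∀ t, 0 < g t ∧ g t ≤ 1) (hgF : ∀ t, 1 / (1 + ∑ k ∈ range K, L k * h (t + k) ^ 3 / 2) ≤ g t) (hgU : ∀ t, g t ≤ gU t)
    {k₂ k₃ : ℕ} (hk2 : 2 ≤ k₂) (hk23 : k₂ < k₃) (hKk : K = k₃ + 1) (hL3 : ∀ j, j < K → j ≠ 1 → j ≠ k₂ → j ≠ k₃ → L j = 0) {N : ℕ} (hKN : K ≤ N)
    (hKL : ∀ k n l, KL k n l = if 0 < k ∧ k < K ∧ l < k then L k * h (n + k) ^ 3 / 2 * ∏ t ∈ Ico (n + 1 + l) (n + k + 1), g t else 0)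
    {θ : ℕ → ℕ → ℕ → ℝ} (hθ : ∀ k n l, θ k n l = 1 - (h (n + k + l) / h (n + k)) ^ 3 * ∏ t ∈ Ico (n + k + 1) (n + k + l + 1), g t)
    {KA : ℕ → ℕ → ℕ → ℝ} {RL RA SL SA : ℕ → (ℕ → ℝ) → ℕ → ℝ}
    (hRL : ∀ i v m, RL i v m = ∑ l ∈ range K, KL i m l * v (m + 1 + l))
    (hRA : ∀ i v m, RA i v m = ∑ l ∈ range K, KA i m l * v (m + 1 + l))
    (hKA : ∀ i m l, KA i m l = KL i m l + KA (i + 1) m l) (hKAtop : ∀ m l, KA K m l = 0)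
    (hSL : ∀ i (w : ℕ → ℝ), (∀ m, N < m → w m = 0) → (∀ m, N < m → SL i w m = 0) ∧ ∀ m, SL i w m = w m - RL i (SL i w) m)
    (hSA : ∀ i (w : ℕ → ℝ), (∀ m, N < m → w m = 0) → (∀ m, N < m → SA i w m = 0) ∧ ∀ m, SA i w m = w m - RA i (SA i w) m)
    {ρ : ℕ → ℕ → ℝ} {β : ℕ → ℕ → ℕ → ℝ}
    (hρ : ∀ i n, 1 ≤ i → i ≤ K - 1 → ρ i n = (∑ l ∈ range K, KL i n l) * (1 + ∑ k ∈ Ioc i (K - 1), θ k n i * β (i + 1) n k) /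
      (1 - ∑ k ∈ Ioc i (K - 1), ∑ l ∈ range i, KL k n l))
    (hβnew : ∀ i n, 1 ≤ i → i ≤ K - 1 → β i n i = ρ i n / (1 - ρ i n))
    (hβold : ∀ i n k, 1 ≤ i → i < k → k ≤ K - 1 → β i n k = β (i + 1) n k / (1 - ρ i n))
    {Hg : ℕ → ℕ → ℝ} (hH : ∀ i m, Hg i m = (1 + ∑ k ∈ Ioc i (K - 1), θ k m 1 * β (i + 1) m k) / (1 - ∑ k ∈ Ioc i (K - 1), KL k m 0))
    {AL : ℕ → ℕ → ℕ → ℝ} (hAL : ∀ i j p, AL i j p = ∑ l ∈ range i, if p + 1 + l ≤ j then KL i p l * (1 - ρ i (p + 1 + l)) else 0)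
    {Tτ : ℕ → ℕ → ℕ → ℝ} (hTτ : ∀ i m p', Tτ i m p' = max (max (max ((1 - ρ i p') * (1 - ∑ l ∈ range K, KA (i + 1) (m + 2) l))
      ((1 - ρ i p') * (1 - ∑ l ∈ range K, KA (i + 1) p' l))) ((1 - ∑ l ∈ range K, KA (i + 1) p' l) - ∑ l ∈ range K, KL i p' l)) 0)
    {TA : ℕ → ℕ → ℕ → ℕ → ℝ} (hTA : ∀ i j m p, TA i j m p = ∑ l ∈ range i, if p + 1 + l ≤ j then KL i p l * Tτ i m (p + 1 + l) else 0)
    {M : ℕ → ℕ → ℝ} (hM : ∀ i m, M i m = KL i m 0 + ∑ l ∈ range (K - 1), max (KL i m (l + 1) - KL i (m + 1) l) 0)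
    {HgS : ℕ → ℕ → ℕ → ℝ} (hHS : ∀ i j m, HgS i j m = (1 + ∑ k ∈ Ioc i (K - 1), θ k m 1 * β (i + 1) m k) /
      (1 - ∑ k ∈ Ioc i (K - 1), (KL k m 0 - if m + 1 + k ≤ j then KL k (m + 1) (k - 1) else 0)))
    (hSb1 : ∀ m, (1 + M 1 m) * (Hg 1 (m + 1) * KL 1 (m + 1) 0) ≤ KL 1 m 0)
    (hpair12 : (∀ n, ∑ l ∈ range k₂, KL k₂ (n + 1) l ≤ ∑ l ∈ range k₂, KL k₂ n l) ∨
      (∀ m, KL k₂ (m + 1) (k₂ - 1) * KL 1 (m + 1 + k₂) 0 * ∏ p ∈ Ico (m + 2) (m + 2 + k₂), Hg 1 p ≤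
        KL k₂ m 0 * KL 1 (m + 1) 0 * (1 - KL 1 (m + 2) 0 * Hg 1 (m + 2))))
    (hpair13 : (∀ n, ∑ l ∈ range k₃, KL k₃ (n + 1) l ≤ ∑ l ∈ range k₃, KL k₃ n l) ∨
      (∀ m, KL k₃ (m + 1) (k₃ - 1) * KL 1 (m + 1 + k₃) 0 * ∏ p ∈ Ico (m + 2) (m + 2 + k₃), Hg 1 p ≤
        KL k₃ m 0 * KL 1 (m + 1) 0 * (1 - KL 1 (m + 2) 0 * Hg 1 (m + 2))))
    (hlev2 : ((∀ m L', L' < k₂ → (1 + M k₂ m) * ∑ l ∈ Ico L' k₂, Hg k₂ (m + 1 + l) * KL k₂ (m + 1) l ≤ ∑ l ∈ Ico L' k₂, KL k₂ m l) ∧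
        (∀ m L₀, L₀ < k₂ → ∀ L', L' ≤ L₀ → (1 + M k₂ m) * ∑ l ∈ Ico L' L₀, Hg k₂ (m + 1 + l) * KL k₂ (m + 1) l ≤ ∑ l ∈ Ico L' (L₀ + 1), KL k₂ m l)) ∨
      (∀ m, KL k₂ (m + 1) (k₂ - 1) ≤ (1 - (1 - θ k₂ m 1)) * ∑ l ∈ range k₂, KL k₂ m l * (1 - ρ k₂ (m + 1 + l)) / ∏ p ∈ Ico (m + 1 + l) (m + 1 + k₂), Hg k₂ p +
        (1 - θ k₂ m 1) * (KL k₂ m 0 * (1 - ρ k₂ (m + 1)) / ∏ p ∈ Ico (m + 1) (m + 1 + k₂), Hg k₂ p)))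
    -- (★h°[gU]) IN PLACE OF `hpair23`
    {q c F ρUp τlo : ℕ → ℝ} {Pf ALa : ℕ → ℕ → ℝ} (hq : ∀ n, q n = L k₂ * h (n + k₂) ^ 3 / 2) (hc : ∀ n, c n = L k₃ * h (n + k₃) ^ 3 / 2)
    (hF : ∀ t, F t = ∑ j ∈ range K, L j * h (t + j) ^ 3 / 2) (hPf : ∀ a b, Pf a b = (∏ t ∈ Ico a (b + 1), (1 + F t))⁻¹)
    (hρUp : ∀ p, ρUp p = (k₂ * q p) * (1 + (1 - (h (p + k₃ + k₂) / h (p + k₃)) ^ 3 * (∏ t ∈ Ico (p + k₃ + 1) (p + k₃ + k₂ + 1), (1 + F t))⁻¹) *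
      ((k₃ * c p) / (1 - k₃ * c p))) / (1 - k₂ * c p))
    (hτlo : ∀ p', τlo p' = max (max ((1 - ρUp p') * (1 - k₃ * c p')) (1 - k₃ * c p' - k₂ * q p')) 0)
    (hALa : ∀ j p, ALa j p = q p * ∑ l ∈ range k₂, if p + 1 + l ≤ j then Pf (p + 1 + l) (p + k₂) * τlo (p + 1 + l) else 0)
    (hprod : ∀ m j, m + 1 + k₃ ≤ j →
      (h (m + k₃ + 1) / h (m + k₃)) ^ 3 * gU (m + k₃ + 1) * q (m + 1 + k₃) *
          (∑ l ∈ range k₂, if m + 2 + k₃ + l ≤ j then ∏ t ∈ Ico (m + 1 + k₃ + 1 + l) (m + 1 + k₃ + k₂ + 1), gU t else 0) ≤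
        (1 - (h (m + k₃ + 1) / h (m + k₃)) ^ 3 * gU (m + k₃ + 1)) * ∑ l' ∈ range k₃, Pf (m + 1 + l') (m + k₃) * ALa j (m + 1 + l') +
          (h (m + k₃ + 1) / h (m + k₃)) ^ 3 * gU (m + k₃ + 1) * (Pf (m + 1) (m + k₃) * ALa j (m + 1)))
    (hM1top' : ((∀ m j, m + 1 + N ≤ j → ∀ L', L' < N →
          ∑ l ∈ Ico L' N, HgS k₂ j (m + 1 + l) * KA (k₂ + 1) (m + 1) l ≤ ∑ l ∈ Ico L' N, KA (k₂ + 1) m l) ∧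
        (∀ m L₀, L₀ < N → ∀ L', L' ≤ L₀ →
          ∑ l ∈ Ico L' L₀, HgS k₂ (m + 1 + L₀) (m + 1 + l) * KA (k₂ + 1) (m + 1) l ≤ ∑ l ∈ Ico L' (L₀ + 1), KA (k₂ + 1) m l)) ∨
      (∀ m, KL k₃ (m + 1) (k₃ - 1) - (1 - θ k₃ m 1) * KL k₃ m 0 ≤
        (∑ l ∈ range k₃, KL k₃ (m + 1) l * (1 - ∑ l' ∈ range k₃, KL k₃ (m + 2 + l) l')) * (1 - (1 - θ k₃ m 1) - (1 - θ k₃ m 1) * KL k₃ m 0)))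
    {e ε : ℕ → ℝ} (he0 : ∀ m, 0 ≤ e m) (hea : ∀ m, e (m + 1) ≤ e m) (het : ∀ m, N < m → e m = 0)
    (hεt : ∀ m, N < m → ε m = 0) (hεrec : ∀ m, ε m = e m - RA 1 ε m) : ∀ m, 0 ≤ ε m := by
  have hpos : ∀ n, 0 < h n := fun n => (hh n).1
  have hanti := (strictAnti_of_memFlow hb hlo hh hf).antitone
  have hk3K : k₃ < K := by omega
  have hρ1 : ∀ p, ρ k₂ p ≤ 1 := fun p =>
    (age_chain_closes hmono hL hb hlo hdom hh hf hg hgF hKL hθ hρ hβnew hβold p (i := k₂) (by omega) (by omega)).1.le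
  have hρle : ∀ p, 2 ≤ p → ρ k₂ p ≤ ρUp p := fun p hp =>
    rho_mid_three_le hmono hL hb hlo hdom hh hf hg hgF hk2 hk23 hKk hL3 hKL hθ hρ hβnew hβold hq hc hF hρUp (by omega)
  have hx34 : ∀ n, 1 ≤ n → k₃ * c n ≤ 3 / 4 := fun n hn => by
    have h1 := load_le_of_window hmono hL hb hlo hdom hh hf hn hk3K
    have h2 : 0 ≤ (h (n + k₃) / h n) ^ 2 := sq_nonneg _
    rw [hc]; linarith
  have hKA3 : ∀ m l, KA (k₂ + 1) m l = KL k₃ m l := fun m l => by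
    have e := aggregate_eq_sum (n := K - 1) hKA (fun m l => by rw [Nat.sub_add_cancel (by omega : 1 ≤ K)]; exact hKAtop m l)
      (show k₂ + 1 ≤ K - 1 + 1 by omega) m l
    rw [e, sum_eq_single_of_mem k₃ (mem_Ico.mpr ⟨by omega, by omega⟩) fun k hk hk3 => ?_]
    obtain ⟨hk1, hk2'⟩ := mem_Ico.mp hk
    exact kernel_zero hKL (hL3 k (by omega) (by omega) (by omega) hk3) m l
  have hXA : ∀ p, 1 ≤ p → ∑ l ∈ range K, KA (k₂ + 1) p l ≤ k₃ * c p := fun p _ => by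
    rw [sum_congr rfl fun l _ => hKA3 p l, hc]; exact row_mass_le hL hh hg hKL hk3K p
  exact flow_nonneg_three_ages_abs_static hmono hL hb hlo hdom hh hf hg hgF hk2 hk23 hKk hL3 hKN hKL hθ hRL hRA hKA hKAtop hSL hSA hρ hβnew hβold hH
    hAL hTτ hTA hM hHS hSb1 hpair12 hpair13 hlev2
    (Or.inr (Or.inr fun j m hm => static_defect_abs_of_product_env hL hh hanti hg hgF hgU hk2 hk23 hk3K hKL hθ hρ1 hq hc hF hPf hx34
      (XA := fun p => ∑ l ∈ range K, KA (k₂ + 1) p l) hXA (fun m p' => hTτ k₂ m p') (fun j m p => hTA k₂ j m p) hρle hτlo hALa (hprod m) j hm))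
    hM1top' he0 hea het hεt hεrec

/-! ## §3 The floor envelope of the self-consistent damping (v1.1) -/

/-- **THE SELF-CONSISTENT DAMPING LIES BELOW THE FLOOR ENVELOPE.**  Route (N)'s pin damping is backward self-consistent, `g_t = 1∕(1+f_t)` with the DAMPED
load `f_t = Σ_{k<K} L_k h_{t+k}³∕2·Π_{i∈[t+1,t+k]} g_i` (README `g62/e71` §0); every such damping of the relaxed class (`g ≥ 1∕(1+F)`) has `f_t ≥ F♭_t :=
Σ_{k<K} L_k h_{t+k}³∕2·(Π_{i∈[t+1,t+k]}(1+F_i))⁻¹` (the floor-damped load), hence `g_t ≤ 1∕(1+F♭_t)`: the envelope `gU = 1∕(1+F♭)` of §1–§2 is admissible for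
it.  In the young-saturated infrared corner this envelope pins the damping (`F♭_t = d_t∕(1+d_{t+1})`), which is what makes (★h°[gU]) k-uniform there
(README g79/e88 §2). [folklore] -/
theorem selfconsistent_le_floor_env (hL : ∀ k, 0 ≤ L k) (hh0 : ∀ n, 0 < h n)
    (hgF : ∀ t, 1 / (1 + ∑ k ∈ range K, L k * h (t + k) ^ 3 / 2) ≤ g t)
    {f F Fb : ℕ → ℝ} (hF : ∀ t, F t = ∑ j ∈ range K, L j * h (t + j) ^ 3 / 2)
    (hf : ∀ t, f t = ∑ k ∈ range K, L k * h (t + k) ^ 3 / 2 * ∏ i ∈ Ico (t + 1) (t + k + 1), g i) (hgdef : ∀ t, g t = 1 / (1 + f t))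
    (hFb : ∀ t, Fb t = ∑ k ∈ range K, L k * h (t + k) ^ 3 / 2 * (∏ i ∈ Ico (t + 1) (t + k + 1), (1 + F i))⁻¹) (t : ℕ) :
    g t ≤ 1 / (1 + Fb t) := by
  have hF0 : ∀ t, 0 ≤ F t := fun t => by
    rw [hF]; exact sum_nonneg fun j _ => by have := hL j; have := hh0 (t + j); positivity
  have hgF' : ∀ t, 1 / (1 + F t) ≤ g t := fun t => by rw [hF]; exact hgF t
  have hFb0 : 0 ≤ Fb t := by
    rw [hFb]; exact sum_nonneg fun k _ => by
      have := hL k; have := hh0 (t + k)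
      exact mul_nonneg (by positivity) (inv_nonneg.mpr (prod_nonneg fun i _ => by have := hF0 i; positivity))
  have hle : Fb t ≤ f t := by
    rw [hFb, hf]
    exact sum_le_sum fun k _ => mul_le_mul_of_nonneg_left (inv_prod_le_prod_damping hF0 hgF' _)
      (by have := hL k; have := hh0 (t + k); positivity)
  rw [hgdef]
  exact one_div_le_one_div_of_le (by linarith) (by linarith)

/-- The floor envelope is itself a damping of the relaxed class: `0 < 1∕(1+F♭_t) ≤ 1`, and `1∕(1+F_t) ≤ 1∕(1+F♭_t)` (`F♭ ≤ F`). [folklore] -/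
theorem floor_env_bounds (hL : ∀ k, 0 ≤ L k) (hh0 : ∀ n, 0 < h n)
    {F Fb : ℕ → ℝ} (hF : ∀ t, F t = ∑ j ∈ range K, L j * h (t + j) ^ 3 / 2)
    (hFb : ∀ t, Fb t = ∑ k ∈ range K, L k * h (t + k) ^ 3 / 2 * (∏ i ∈ Ico (t + 1) (t + k + 1), (1 + F i))⁻¹) (t : ℕ) :
    (0 < 1 / (1 + Fb t) ∧ 1 / (1 + Fb t) ≤ 1) ∧ 1 / (1 + F t) ≤ 1 / (1 + Fb t) := by
  have hF0 : ∀ t, 0 ≤ F t := fun t => by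
    rw [hF]; exact sum_nonneg fun j _ => by have := hL j; have := hh0 (t + j); positivity
  have hterm : ∀ k, 0 ≤ L k * h (t + k) ^ 3 / 2 := fun k => by have := hL k; have := hh0 (t + k); positivity
  have hP : ∀ k, 0 ≤ (∏ i ∈ Ico (t + 1) (t + k + 1), (1 + F i))⁻¹ ∧ (∏ i ∈ Ico (t + 1) (t + k + 1), (1 + F i))⁻¹ ≤ 1 := fun k => by
    have h1 : 1 ≤ ∏ i ∈ Ico (t + 1) (t + k + 1), (1 + F i) :=
      le_of_eq_of_le (prod_const_one (s := Ico (t + 1) (t + k + 1))).symm (prod_le_prod (fun i _ => zero_le_one) fun i _ => by linarith [hF0 i])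
    exact ⟨inv_nonneg.mpr (by linarith), inv_le_one_of_one_le₀ h1⟩
  have hFb0 : 0 ≤ Fb t := by rw [hFb]; exact sum_nonneg fun k _ => mul_nonneg (hterm k) (hP k).1
  have hFbF : Fb t ≤ F t := by
    rw [hFb, hF]
    exact sum_le_sum fun k _ => by have := mul_le_mul_of_nonneg_left (hP k).2 (hterm k); linarith
  refine ⟨⟨by positivity, ?_⟩, one_div_le_one_div_of_le (by linarith) (by linarith)⟩
  rw [div_le_one (by linarith)]; linarith

end Summit.QuantumFields.BalabanUV.Beta.EriceRemainderEnclosureHistoryAutonomyComparisonAgeCompositionThreeAgesDefectEnvelope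

end
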